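import Summits.HodgeConjecture.CorCM.Census.CoverClosureMeta

/-!
# The square-central class, I: STRICT lowering covers — at every far type that admits one, the cover face has uniquely-directed corners

COR-CM (cell `pub-hodgecm2`), count-neutral kernel combinatorics by the binder seat b09 (gen 45; lane SQUARE-CENTRAL CLASS, part I — still
model-free), on top of part 0 (`Census/CoverClosureMeta.lean`: `exists_lowering_cover`, the cover-closure meta-theorem) and gen 38ʼs
`Census/BaseBlockCovering.lean` (`bpot`, `exists_choice`, `bpot_corners_lt`, `par_cover_self/other`), all BY NAME.  Theorems only: no definition, no `decide`,
no certificate, no named fact, no `sorry`.  HONEST FRAMING: `HC_CM` is NOT proved, here or anywhere in the tree; nothing here is a period or a headline.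

WHY.  The cover-closure law (part 0, `isLeast_card_gfaces_generate_of_residual_closure_par`) closes a `2`-group row from ONE parity-independent face family
`S` that reduces every type to the residual types of a base type `T₀` and closes the residual Hodge lattice up to a power of `2`.  For the rows of this lane
(`D₄ × E`, Pauli `× E`, `2^{1+2k}_± × E`, …; numerics `HOME/pub-hodgecm2-b09/lean-g45/CENTRAL-SQUARES.md`) the residual relations come from STABILISED TIE TYPES —
far types with two nearest base changes swapped by a stabiliser element — and they are legible only when the cover face at such a type, and at the tie types two
levels above it, lowers through corners whose nearest base change is UNIQUE («strict» faces): then gen 32ʼs restricted star reduction gives both star normal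
forms and their difference is an explicit residual relation.  An arbitrary lowering cover need not be strict where it could be (an adversarial cover makes the
level-`(n/4+2)` relations of `D₄ × E` trivial and pushes the closing to level `n/2`); this file constructs a cover that IS strict wherever strictness is available.

* §1 `nearestUnique` bookkeeping without a definition: the property `U(Q, X) :≡ ∀ Q', ddist (T₀·Q'⁻¹) X = bpot X → T₀·Q'⁻¹ = T₀·Q⁻¹` («`T₀·Q⁻¹` is the ONLY
  nearest base change of `X`») is transported along base change (`unique_rt`), and so are strict lowering triples (`strict_rt`).
* §2 **THE STRICT LOWERING COVER** (`exists_strict_lowering_cover`): for every base type `T₀` a face family `S ⊆ gfaceSet` with exactly one member per block of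
  potential `≥ 2`, PARITY-independent (pivot = own block, rank = potential), such that through EVERY type `Ψ` of potential `≥ 2` the base changes of `S` contain a
  lowering face `gface Ψ s s'` toward a nearest base change `T₀·Q⁻¹` (`s ≠ s'` deviation places) which is STRICT — its three corners `Ψ^{(s)}`, `Ψ^{(s')}`,
  `Ψ^{(s s')}` have `T₀·Q⁻¹` as their unique nearest base change — WHENEVER `Ψ` admits any strict lowering face; and every vector is congruent modulo any
  lattice containing the base changes of `S` to one supported on the residual types.
* §3 **THE STRICT COVER-CLOSURE LAW** (`isLeast_card_gfaces_generate_of_strict_cover_closure`, `…_typeSum`): for a `2`-group it suffices to close the residual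
  Hodge vectors up to `2^k` modulo `ℤ⟨pairs⟩ + ℤ⟨base changes of S⟩` for every STRICT lowering cover `S` of `T₀`.

## References
* [Pohlmann1968] H. Pohlmann, Algebraic cycles on abelian varieties of complex multiplication type, Ann. of Math. 88 (1968), Thm 1.
* [Milne1999] J. S. Milne, Lefschetz motives and the Tate conjecture, Compositio Math. 117 (1999), Prop. 2.1, p. 54.
-/

namespace Summit.HodgeConjecture.CorCM.Census.CoverClosure

open Finset
open Summit.HodgeConjecture.CorCM.Prior.AllgGroup.RfwfAllgGroup
open Summit.HodgeConjecture.CorCM.Census.BlockParity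
open Summit.HodgeConjecture.CorCM.Census.Coinvariant
open Summit.HodgeConjecture.CorCM.Census.TwistGeneration
open Summit.HodgeConjecture.CorCM.Census.BaseBlock
open Summit.HodgeConjecture.CorCM.Census.Splitting

noncomputable section

variable {G : Type*} [Group G] [Fintype G] [DecidableEq G] (c : G) (T₀ : CMF G c)

/-! ## §1 Unique nearest base changes and strict triples under base change -/

/-- **Transport of «unique nearest base change»**: if `T₀·R⁻¹` is the only nearest base change of `X`, then `T₀·(QR)⁻¹` is the only nearest base change of
`X·Q⁻¹`. [folklore] -/
theorem unique_rt {X : CMF G c} {R : G} (hU : ∀ Q' : G, ddist (rt c Q' T₀) X = bpot c T₀ X → rt c Q' T₀ = rt c R T₀) (Q : G) :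
    ∀ Q' : G, ddist (rt c Q' T₀) (rt c Q X) = bpot c T₀ (rt c Q X) → rt c Q' T₀ = rt c (Q * R) T₀ := by
  intro Q' hQ'
  have e : rt c Q' T₀ = rt c Q (rt c (Q⁻¹ * Q') T₀) := by rw [← rt_mul, mul_inv_cancel_left]
  rw [e, ddist_rt, bpot_rt] at hQ'
  rw [e, hU _ hQ', ← rt_mul]

/-- **Transport of a strict lowering triple** along a base change `Q`: nearest base change, deviation places, distinctness and the uniqueness of the nearest
base change at the three corners all move from `X` to `X·Q⁻¹`. [folklore] -/
theorem strict_rt (hc2 : c * c = 1) {X : CMF G c} {R t t' : G} (Q : G) (h1 : bpot c T₀ X = ddist (rt c R T₀) X)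
    (ht : t ∈ (rt c R T₀).1 \ X.1) (ht' : t' ∈ (rt c R T₀).1 \ X.1) (htt' : t ≠ t')
    (hu1 : ∀ Q' : G, ddist (rt c Q' T₀) (oflipCM c hc2 t X) = bpot c T₀ (oflipCM c hc2 t X) → rt c Q' T₀ = rt c R T₀)
    (hu2 : ∀ Q' : G, ddist (rt c Q' T₀) (oflipCM c hc2 t' X) = bpot c T₀ (oflipCM c hc2 t' X) → rt c Q' T₀ = rt c R T₀)
    (hu3 : ∀ Q' : G, ddist (rt c Q' T₀) (oflipCM c hc2 t (oflipCM c hc2 t' X)) = bpot c T₀ (oflipCM c hc2 t (oflipCM c hc2 t' X)) →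
      rt c Q' T₀ = rt c R T₀) :
    bpot c T₀ (rt c Q X) = ddist (rt c (Q * R) T₀) (rt c Q X) ∧
      t * Q⁻¹ ∈ (rt c (Q * R) T₀).1 \ (rt c Q X).1 ∧ t' * Q⁻¹ ∈ (rt c (Q * R) T₀).1 \ (rt c Q X).1 ∧ t * Q⁻¹ ≠ t' * Q⁻¹ ∧
      (∀ Q' : G, ddist (rt c Q' T₀) (oflipCM c hc2 (t * Q⁻¹) (rt c Q X)) = bpot c T₀ (oflipCM c hc2 (t * Q⁻¹) (rt c Q X)) →
        rt c Q' T₀ = rt c (Q * R) T₀) ∧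
      (∀ Q' : G, ddist (rt c Q' T₀) (oflipCM c hc2 (t' * Q⁻¹) (rt c Q X)) = bpot c T₀ (oflipCM c hc2 (t' * Q⁻¹) (rt c Q X)) →
        rt c Q' T₀ = rt c (Q * R) T₀) ∧
      (∀ Q' : G, ddist (rt c Q' T₀) (oflipCM c hc2 (t * Q⁻¹) (oflipCM c hc2 (t' * Q⁻¹) (rt c Q X))) =
          bpot c T₀ (oflipCM c hc2 (t * Q⁻¹) (oflipCM c hc2 (t' * Q⁻¹) (rt c Q X))) → rt c Q' T₀ = rt c (Q * R) T₀) := by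
  refine ⟨?_, ?_, ?_, fun h => htt' (mul_right_cancel h), ?_, ?_, ?_⟩
  · rw [bpot_rt, rt_mul, ddist_rt]; exact h1
  · rw [rt_mul, mem_sdiff_rt_iff, inv_mul_cancel_right]; exact ht
  · rw [rt_mul, mem_sdiff_rt_iff, inv_mul_cancel_right]; exact ht'
  · rw [← rt_oflipCM]; exact unique_rt c T₀ hu1 Q
  · rw [← rt_oflipCM]; exact unique_rt c T₀ hu2 Q
  · rw [← rt_oflipCM, ← rt_oflipCM]; exact unique_rt c T₀ hu3 Q

/-! ## §2 The strict lowering cover -/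

/-- **THE STRICT LOWERING COVER** of the base type `T₀`.  As `exists_lowering_cover` (one face per block of potential `≥ 2`, parity-independent, lowering
through every far type, potential descent), and in addition: at every type `Ψ` of potential `≥ 2` that admits SOME strict lowering face (two distinct deviation
places toward a nearest base change `T₀·Q₁⁻¹` such that each of the three corners has `T₀·Q₁⁻¹` as its ONLY nearest base change), the face supplied through `Ψ`
is itself strict. [folklore] -/
theorem exists_strict_lowering_cover (hc2 : c * c = 1) :
    ∃ S : Finset (CMF G c →₀ ℤ), (↑S ⊆ gfaceSet G c hc2) ∧
      S.card = (univ.filter fun Bk : Block c => 2 ≤ bpot c T₀ Bk.out).card ∧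
      LinearIndepOn (ZMod 2) (fun f : CMF G c →₀ ℤ => par c f) ↑S ∧
      (∀ Ψ : CMF G c, 2 ≤ bpot c T₀ Ψ → ∃ Q s s' : G, bpot c T₀ Ψ = ddist (rt c Q T₀) Ψ ∧
        s ∈ (rt c Q T₀).1 \ Ψ.1 ∧ s' ∈ (rt c Q T₀).1 \ Ψ.1 ∧ s ≠ s' ∧
        gface c hc2 Ψ s s' ∈ Submodule.span ℤ (translates c S) ∧
        ((∃ Q₁ t t' : G, bpot c T₀ Ψ = ddist (rt c Q₁ T₀) Ψ ∧ t ∈ (rt c Q₁ T₀).1 \ Ψ.1 ∧ t' ∈ (rt c Q₁ T₀).1 \ Ψ.1 ∧ t ≠ t' ∧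
            (∀ Q' : G, ddist (rt c Q' T₀) (oflipCM c hc2 t Ψ) = bpot c T₀ (oflipCM c hc2 t Ψ) → rt c Q' T₀ = rt c Q₁ T₀) ∧
            (∀ Q' : G, ddist (rt c Q' T₀) (oflipCM c hc2 t' Ψ) = bpot c T₀ (oflipCM c hc2 t' Ψ) → rt c Q' T₀ = rt c Q₁ T₀) ∧
            (∀ Q' : G, ddist (rt c Q' T₀) (oflipCM c hc2 t (oflipCM c hc2 t' Ψ)) = bpot c T₀ (oflipCM c hc2 t (oflipCM c hc2 t' Ψ)) →
              rt c Q' T₀ = rt c Q₁ T₀)) →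
          (∀ Q' : G, ddist (rt c Q' T₀) (oflipCM c hc2 s Ψ) = bpot c T₀ (oflipCM c hc2 s Ψ) → rt c Q' T₀ = rt c Q T₀) ∧
          (∀ Q' : G, ddist (rt c Q' T₀) (oflipCM c hc2 s' Ψ) = bpot c T₀ (oflipCM c hc2 s' Ψ) → rt c Q' T₀ = rt c Q T₀) ∧
          (∀ Q' : G, ddist (rt c Q' T₀) (oflipCM c hc2 s (oflipCM c hc2 s' Ψ)) = bpot c T₀ (oflipCM c hc2 s (oflipCM c hc2 s' Ψ)) →
            rt c Q' T₀ = rt c Q T₀))) ∧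
      ∀ L : Submodule ℤ (CMF G c →₀ ℤ), Submodule.span ℤ (translates c S) ≤ L →
        ∀ y : CMF G c →₀ ℤ, ∃ y' : CMF G c →₀ ℤ, y - y' ∈ L ∧ ∀ Ψ ∈ y'.support, bpot c T₀ Ψ ≤ 1 := by
  classical
  -- strictness of a triple `(Q, t, t')` at a type `X`, as a predicate (local abbreviation inside the proof)
  let Str : CMF G c → G × G × G → Prop := fun X τ =>
    bpot c T₀ X = ddist (rt c τ.1 T₀) X ∧ τ.2.1 ∈ (rt c τ.1 T₀).1 \ X.1 ∧ τ.2.2 ∈ (rt c τ.1 T₀).1 \ X.1 ∧ τ.2.1 ≠ τ.2.2 ∧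
      (∀ Q' : G, ddist (rt c Q' T₀) (oflipCM c hc2 τ.2.1 X) = bpot c T₀ (oflipCM c hc2 τ.2.1 X) → rt c Q' T₀ = rt c τ.1 T₀) ∧
      (∀ Q' : G, ddist (rt c Q' T₀) (oflipCM c hc2 τ.2.2 X) = bpot c T₀ (oflipCM c hc2 τ.2.2 X) → rt c Q' T₀ = rt c τ.1 T₀) ∧
      (∀ Q' : G, ddist (rt c Q' T₀) (oflipCM c hc2 τ.2.1 (oflipCM c hc2 τ.2.2 X)) = bpot c T₀ (oflipCM c hc2 τ.2.1 (oflipCM c hc2 τ.2.2 X)) →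
        rt c Q' T₀ = rt c τ.1 T₀)
  have hStr_rt : ∀ (X : CMF G c) (τ : G × G × G) (Q : G), Str X τ → Str (rt c Q X) (Q * τ.1, τ.2.1 * Q⁻¹, τ.2.2 * Q⁻¹) := by
    rintro X ⟨R, t, t'⟩ Q ⟨h1, ht, ht', htt', hu1, hu2, hu3⟩
    exact strict_rt c T₀ hc2 Q h1 ht ht' htt' hu1 hu2 hu3
  -- the choice at every block representative of potential `≥ 2`: strict if possible, lowering always
  have hch : ∀ Bk : Block c, ∃ τ : G × G × G, (2 ≤ bpot c T₀ Bk.out →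
      bpot c T₀ Bk.out = ddist (rt c τ.1 T₀) Bk.out ∧
        τ.2.1 ∈ (rt c τ.1 T₀).1 \ Bk.out.1 ∧ τ.2.2 ∈ (rt c τ.1 T₀).1 \ Bk.out.1 ∧ τ.2.1 ≠ τ.2.2) ∧
      ((∃ τ₁ : G × G × G, Str Bk.out τ₁) → Str Bk.out τ) := by
    intro Bk
    by_cases hs : ∃ τ₁ : G × G × G, Str Bk.out τ₁
    · obtain ⟨τ₁, hτ₁⟩ := hs
      exact ⟨τ₁, fun _ => ⟨hτ₁.1, hτ₁.2.1, hτ₁.2.2.1, hτ₁.2.2.2.1⟩, fun _ => hτ₁⟩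
    · by_cases h : 2 ≤ bpot c T₀ Bk.out
      · obtain ⟨Q, t, t', h1, h3, h4, h5⟩ := exists_choice c T₀ Bk.out h
        exact ⟨(Q, t, t'), fun _ => ⟨h1, h3, h4, h5⟩, fun h' => absurd h' hs⟩
      · exact ⟨(1, 1, 1), fun h' => absurd h' h, fun h' => absurd h' hs⟩
  choose τ hτlow hτstr using hch
  set NI : Finset (Block c) := univ.filter fun Bk : Block c => 2 ≤ bpot c T₀ Bk.out with hNI
  set face : Block c → (CMF G c →₀ ℤ) := fun Bk => gface c hc2 Bk.out (τ Bk).2.1 (τ Bk).2.2 with hfaceDef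
  set S : Finset (CMF G c →₀ ℤ) := NI.image face with hS
  have hself : ∀ Bk ∈ NI, par c (face Bk) Bk = 1 := by
    intro Bk hBk
    obtain ⟨h1, h3, h4, h5⟩ := hτlow Bk (mem_filter.mp hBk).2
    have h := par_cover_self c T₀ hc2 h1 h3 h4 h5
    rwa [blk_out] at h
  have hother : ∀ Bk ∈ NI, ∀ B : Block c, B ≠ Bk → bpot c T₀ Bk.out ≤ bpot c T₀ B.out → par c (face Bk) B = 0 := by
    intro Bk hBk B hB hle
    obtain ⟨h1, h3, h4, h5⟩ := hτlow Bk (mem_filter.mp hBk).2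
    exact par_cover_other c T₀ hc2 h1 h3 h4 h5 (by rw [blk_out]; exact hB) hle
  have hinj : Set.InjOn face ↑NI := by
    intro B₁ hB₁ B₂ hB₂ heq
    by_contra hne
    rcases le_total (bpot c T₀ B₁.out) (bpot c T₀ B₂.out) with hle | hle
    · have h0 := hother B₁ hB₁ B₂ (Ne.symm hne) hle
      rw [heq, hself B₂ hB₂] at h0
      exact one_ne_zero h0
    · have h0 := hother B₂ hB₂ B₁ hne hle
      rw [← heq, hself B₁ hB₁] at h0
      exact one_ne_zero h0
  have hSsub : (↑S : Set (CMF G c →₀ ℤ)) ⊆ gfaceSet G c hc2 := by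
    intro y hy
    obtain ⟨Bk, hBk, rfl⟩ := mem_image.mp (mem_coe.mp hy)
    obtain ⟨-, h3, h4, h5⟩ := hτlow Bk (mem_filter.mp hBk).2
    exact ⟨Bk.out, _, _, not_mem_orb_of_mem (mem_sdiff.mp h3).1 (mem_sdiff.mp h4).1 h5, rfl⟩
  -- the lowering property with strictness transfer
  have hlow : ∀ Ψ : CMF G c, 2 ≤ bpot c T₀ Ψ → ∃ Q s s' : G, bpot c T₀ Ψ = ddist (rt c Q T₀) Ψ ∧
      s ∈ (rt c Q T₀).1 \ Ψ.1 ∧ s' ∈ (rt c Q T₀).1 \ Ψ.1 ∧ s ≠ s' ∧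
      gface c hc2 Ψ s s' ∈ Submodule.span ℤ (translates c S) ∧
      ((∃ τ₁ : G × G × G, Str Ψ τ₁) → Str Ψ (Q, s, s')) := by
    intro Ψ hΨ2
    obtain ⟨Q, hQ⟩ := exists_rt_eq_of_blk_eq c (Quotient.out_eq (blk c Ψ) : blk c (blk c Ψ).out = blk c Ψ)
    have hBNI : blk c Ψ ∈ NI := mem_filter.mpr ⟨mem_univ _, by rw [bpot_out]; exact hΨ2⟩
    obtain ⟨h1, h3, h4, h5⟩ := hτlow (blk c Ψ) (mem_filter.mp hBNI).2
    set R := (τ (blk c Ψ)).1 with hR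
    set t := (τ (blk c Ψ)).2.1 with ht
    set t' := (τ (blk c Ψ)).2.2 with ht'
    refine ⟨Q * R, t * Q⁻¹, t' * Q⁻¹, ?_, ?_, ?_, fun h => h5 (mul_right_cancel h), ?_, fun hex => ?_⟩
    · rw [← hQ, bpot_rt, rt_mul, ddist_rt]; exact h1
    · rw [rt_mul, ← hQ, mem_sdiff_rt_iff, inv_mul_cancel_right]; exact h3
    · rw [rt_mul, ← hQ, mem_sdiff_rt_iff, inv_mul_cancel_right]; exact h4
    · have e : gface c hc2 Ψ (t * Q⁻¹) (t' * Q⁻¹) = Finsupp.mapDomain (rt c Q) (face (blk c Ψ)) := by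
        rw [mapDomain_rt_gface, hQ]
      rw [e]
      exact Submodule.subset_span ⟨Q, _, mem_image_of_mem _ hBNI, rfl⟩
    · -- a strict triple at `Ψ` transports to one at the block representative, so `τ` is strict there, and transports back
      obtain ⟨τ₁, hτ₁⟩ := hex
      have hrep : Str (blk c Ψ).out (τ (blk c Ψ)) := by
        refine hτstr (blk c Ψ) ⟨(Q⁻¹ * τ₁.1, τ₁.2.1 * Q⁻¹⁻¹, τ₁.2.2 * Q⁻¹⁻¹), ?_⟩
        have h := hStr_rt Ψ τ₁ Q⁻¹ hτ₁
        rwa [← hQ, rt_inv_rt] at h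
      have hback := hStr_rt (blk c Ψ).out (τ (blk c Ψ)) Q hrep
      rw [hQ] at hback
      exact hback
  refine ⟨S, hSsub, card_image_of_injOn hinj, ?_, fun Ψ hΨ => ?_, fun L hL y => ?_⟩
  · -- parity independence by the pivot criterion (pivot = own block, rank = potential)
    set p : (CMF G c →₀ ℤ) → Block c := fun f => if h : ∃ Bk ∈ NI, face Bk = f then h.choose else blk c T₀ with hp
    have hpf : ∀ Bk ∈ NI, p (face Bk) = Bk := by
      intro Bk hBk
      have h : ∃ B ∈ NI, face B = face Bk := ⟨Bk, hBk, rfl⟩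
      rw [hp]; simp only [dif_pos h]
      exact hinj h.choose_spec.1 hBk h.choose_spec.2
    rw [LinearIndepOn, linearIndependent_iff']
    intro t g hsum i₁ hi₁
    by_contra hgi₁
    obtain ⟨i₀, hi₀, hmax⟩ := Finset.exists_max_image (t.filter fun i => g i ≠ 0) (fun i => bpot c T₀ (p i.1).out)
      ⟨i₁, mem_filter.mpr ⟨hi₁, hgi₁⟩⟩
    obtain ⟨hi₀t, hgi₀⟩ := mem_filter.mp hi₀
    obtain ⟨B₀, hB₀, hfB₀⟩ := mem_image.mp i₀.2
    have hp₀ : p i₀.1 = B₀ := by rw [← hfB₀]; exact hpf B₀ hB₀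
    have heval := congrFun hsum B₀
    rw [Finset.sum_apply, Pi.zero_apply, Finset.sum_eq_single_of_mem i₀ hi₀t] at heval
    · rw [Pi.smul_apply, smul_eq_mul, ← hfB₀, hself B₀ hB₀, mul_one] at heval
      exact hgi₀ heval
    · intro j hjt hji
      rw [Pi.smul_apply, smul_eq_mul]
      by_cases hgj : g j = 0
      · rw [hgj, zero_mul]
      · obtain ⟨Bj, hBj, hfBj⟩ := mem_image.mp j.2
        have hpj : p j.1 = Bj := by rw [← hfBj]; exact hpf Bj hBj
        have hlj : bpot c T₀ Bj.out ≤ bpot c T₀ B₀.out := by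
          have h := hmax j (mem_filter.mpr ⟨hjt, hgj⟩)
          rwa [hpj, hp₀] at h
        have hne : B₀ ≠ Bj := fun e => hji (Subtype.ext (by rw [← hfBj, ← hfB₀, e]))
        rw [← hfBj, hother Bj hBj B₀ hne hlj, mul_zero]
  · -- the exported lowering + strictness property
    obtain ⟨Q, s, s', hQ, hs, hs', hss', hmem, hstr⟩ := hlow Ψ hΨ
    refine ⟨Q, s, s', hQ, hs, hs', hss', hmem, fun hex => ?_⟩
    obtain ⟨Q₁, t, t', h1, ht, ht', htt', hu1, hu2, hu3⟩ := hex
    obtain ⟨-, -, -, -, k1, k2, k3⟩ := hstr ⟨(Q₁, t, t'), h1, ht, ht', htt', hu1, hu2, hu3⟩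
    exact ⟨k1, k2, k3⟩
  · -- descent on the potential, fed by the lowering property
    refine descent c (bpot c T₀) (fun Ψ => bpot c T₀ Ψ ≤ 1) hc2 L (fun Ψ hΨ => ?_) y
    obtain ⟨Q, s, s', hQ, hs, hs', hss', hmem, -⟩ := hlow Ψ (by omega)
    exact ⟨s, s', hL hmem, bpot_corners_lt c T₀ hc2 hQ hs hs' hss'⟩

/-! ## §3 The strict cover-closure law -/

/-- **THE STRICT COVER-CLOSURE LAW.**  `G` a `2`-group, `c` a central involution `≠ 1`, `T₀` any base type: if for every STRICT lowering cover `S` of `T₀`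
(lowering through every far type, strict wherever a strict lowering face exists) every residual Hodge vector lies in `ℤ⟨pairs⟩ + ℤ⟨base changes of S⟩` up to
`2^k`, then **`μ(G,c) = φ₂(G,c)`**. [folklore] -/
theorem isLeast_card_gfaces_generate_of_strict_cover_closure (hG : IsPGroup 2 G) (hc2 : c * c = 1) (hc1 : c ≠ 1)
    (hcen : ∀ x : G, x * c = c * x) (k : ℕ)
    (hres : ∀ S : Finset (CMF G c →₀ ℤ), (↑S ⊆ gfaceSet G c hc2) →
      (∀ Ψ : CMF G c, 2 ≤ bpot c T₀ Ψ → ∃ Q s s' : G, bpot c T₀ Ψ = ddist (rt c Q T₀) Ψ ∧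
        s ∈ (rt c Q T₀).1 \ Ψ.1 ∧ s' ∈ (rt c Q T₀).1 \ Ψ.1 ∧ s ≠ s' ∧
        gface c hc2 Ψ s s' ∈ Submodule.span ℤ (translates c S) ∧
        ((∃ Q₁ t t' : G, bpot c T₀ Ψ = ddist (rt c Q₁ T₀) Ψ ∧ t ∈ (rt c Q₁ T₀).1 \ Ψ.1 ∧ t' ∈ (rt c Q₁ T₀).1 \ Ψ.1 ∧ t ≠ t' ∧
            (∀ Q' : G, ddist (rt c Q' T₀) (oflipCM c hc2 t Ψ) = bpot c T₀ (oflipCM c hc2 t Ψ) → rt c Q' T₀ = rt c Q₁ T₀) ∧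
            (∀ Q' : G, ddist (rt c Q' T₀) (oflipCM c hc2 t' Ψ) = bpot c T₀ (oflipCM c hc2 t' Ψ) → rt c Q' T₀ = rt c Q₁ T₀) ∧
            (∀ Q' : G, ddist (rt c Q' T₀) (oflipCM c hc2 t (oflipCM c hc2 t' Ψ)) = bpot c T₀ (oflipCM c hc2 t (oflipCM c hc2 t' Ψ)) →
              rt c Q' T₀ = rt c Q₁ T₀)) →
          (∀ Q' : G, ddist (rt c Q' T₀) (oflipCM c hc2 s Ψ) = bpot c T₀ (oflipCM c hc2 s Ψ) → rt c Q' T₀ = rt c Q T₀) ∧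
          (∀ Q' : G, ddist (rt c Q' T₀) (oflipCM c hc2 s' Ψ) = bpot c T₀ (oflipCM c hc2 s' Ψ) → rt c Q' T₀ = rt c Q T₀) ∧
          (∀ Q' : G, ddist (rt c Q' T₀) (oflipCM c hc2 s (oflipCM c hc2 s' Ψ)) = bpot c T₀ (oflipCM c hc2 s (oflipCM c hc2 s' Ψ)) →
            rt c Q' T₀ = rt c Q T₀))) →
      ∀ y ∈ hodgeSpan c hc2, (∀ Ψ ∈ y.support, bpot c T₀ Ψ ≤ 1) →
        ((2 : ℤ) ^ k) • y ∈ Submodule.span ℤ (pairSet c) ⊔ Submodule.span ℤ (translates c S)) :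
    IsLeast {n : ℕ | ∃ S : Finset (CMF G c →₀ ℤ), (↑S ⊆ gfaceSet G c hc2) ∧ S.card = n ∧
      hodgeSpan c hc2 ≤ Submodule.span ℤ (pairSet c) ⊔ Submodule.span ℤ (translates c S)} (fibreTwo c hc2) := by
  obtain ⟨S, hS, -, hli, hlow, hdesc⟩ := exists_strict_lowering_cover c T₀ hc2
  exact isLeast_card_gfaces_generate_of_residual_closure_par c hG hc2 hc1 hcen S hS hli (fun Ψ => bpot c T₀ Ψ ≤ 1) k
    (fun y => hdesc _ le_sup_right y) (hres S hS hlow)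

/-- **THE STRICT COVER-CLOSURE LAW, type-sum form**: it suffices to put into `ℤ⟨pairs⟩ + ℤ⟨base changes of S⟩`, up to `2^k`, every vector supported on
residual types whose type sum is constant, for every strict lowering cover `S`. [folklore] -/
theorem isLeast_card_gfaces_generate_of_strict_cover_closure_typeSum (hG : IsPGroup 2 G) (hc2 : c * c = 1) (hc1 : c ≠ 1)
    (hcen : ∀ x : G, x * c = c * x) (k : ℕ)
    (hres : ∀ S : Finset (CMF G c →₀ ℤ), (↑S ⊆ gfaceSet G c hc2) →
      (∀ Ψ : CMF G c, 2 ≤ bpot c T₀ Ψ → ∃ Q s s' : G, bpot c T₀ Ψ = ddist (rt c Q T₀) Ψ ∧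
        s ∈ (rt c Q T₀).1 \ Ψ.1 ∧ s' ∈ (rt c Q T₀).1 \ Ψ.1 ∧ s ≠ s' ∧
        gface c hc2 Ψ s s' ∈ Submodule.span ℤ (translates c S) ∧
        ((∃ Q₁ t t' : G, bpot c T₀ Ψ = ddist (rt c Q₁ T₀) Ψ ∧ t ∈ (rt c Q₁ T₀).1 \ Ψ.1 ∧ t' ∈ (rt c Q₁ T₀).1 \ Ψ.1 ∧ t ≠ t' ∧
            (∀ Q' : G, ddist (rt c Q' T₀) (oflipCM c hc2 t Ψ) = bpot c T₀ (oflipCM c hc2 t Ψ) → rt c Q' T₀ = rt c Q₁ T₀) ∧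
            (∀ Q' : G, ddist (rt c Q' T₀) (oflipCM c hc2 t' Ψ) = bpot c T₀ (oflipCM c hc2 t' Ψ) → rt c Q' T₀ = rt c Q₁ T₀) ∧
            (∀ Q' : G, ddist (rt c Q' T₀) (oflipCM c hc2 t (oflipCM c hc2 t' Ψ)) = bpot c T₀ (oflipCM c hc2 t (oflipCM c hc2 t' Ψ)) →
              rt c Q' T₀ = rt c Q₁ T₀)) →
          (∀ Q' : G, ddist (rt c Q' T₀) (oflipCM c hc2 s Ψ) = bpot c T₀ (oflipCM c hc2 s Ψ) → rt c Q' T₀ = rt c Q T₀) ∧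
          (∀ Q' : G, ddist (rt c Q' T₀) (oflipCM c hc2 s' Ψ) = bpot c T₀ (oflipCM c hc2 s' Ψ) → rt c Q' T₀ = rt c Q T₀) ∧
          (∀ Q' : G, ddist (rt c Q' T₀) (oflipCM c hc2 s (oflipCM c hc2 s' Ψ)) = bpot c T₀ (oflipCM c hc2 s (oflipCM c hc2 s' Ψ)) →
            rt c Q' T₀ = rt c Q T₀))) →
      ∀ y : CMF G c →₀ ℤ, (∀ Ψ ∈ y.support, bpot c T₀ Ψ ≤ 1) → ∀ m : ℤ, (∀ x : G, typeSum G c y x = m) →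
        ((2 : ℤ) ^ k) • y ∈ Submodule.span ℤ (pairSet c) ⊔ Submodule.span ℤ (translates c S)) :
    IsLeast {n : ℕ | ∃ S : Finset (CMF G c →₀ ℤ), (↑S ⊆ gfaceSet G c hc2) ∧ S.card = n ∧
      hodgeSpan c hc2 ≤ Submodule.span ℤ (pairSet c) ⊔ Submodule.span ℤ (translates c S)} (fibreTwo c hc2) := by
  refine isLeast_card_gfaces_generate_of_strict_cover_closure c T₀ hG hc2 hc1 hcen k fun S hS hlow y hy hyR => ?_
  obtain ⟨m, hm⟩ := (mem_hodgeSpan_iff c hc2 hc1 hcen y).mp hy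
  exact hres S hS hlow y hyR m hm

end

end Summit.HodgeConjecture.CorCM.Census.CoverClosure
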